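import Summits.AtomisticToContinuum.Crystallization.Theses.FluxTubeKepler

/-!
# `FluxCellKepler` (stmt-AtomisticToContinuum-15221), line `Sketch` — helper II: transfer principle and
# pointwise-to-sum (the summation step of every Hales-type cell inequality)

Two potential-free bookkeeping lemmas through which the KEPLER conjunct of
`FluxTubeKepler.FluxCellKepler` is entered in the line's intended proof (cards
`pythagoras-registered-ledger` §Transfer, `flux-cell-m-potential` PointwiseEnvelope):

* `stub_transferPrinciple` — an ANTISYMMETRIC transfer `t i j = −t j i` between cells does not change
  the total score: `Σ_i (λ_i + Σ_j t i j) = Σ_i λ_i`.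
* `stub_keplerOfPointwise` — if a calibrated score `μ` is a lower envelope in sum of the cell score
  (`Σ μ ≤ Σ λ`), is `≥ e` at every site and `≥ e + c` at every bad site (`c ≥ 0`), then
  `c · #bad ≤ Σ_i λ_i − N e` — KEPLER at one scale from a pointwise inequality.
-/

namespace Summit.AtomisticToContinuum.Crystallization.Theorems.FluxCellKeplerSketch

open scoped BigOperators

/-- **Transfer principle.** An antisymmetric transfer between the cells of a finite configuration
leaves the total cell score unchanged: `Σ_i (λ_i + Σ_j t i j) = Σ_i λ_i` when `t i j = −t j i`.
[folklore] -/
theorem stub_transferPrinciple : ∀ (N : ℕ) (score : Fin N → ℝ) (t : Fin N → Fin N → ℝ), (∀ i j, t i j = -t j i) → ∑ i, (score i + ∑ j, t i j) = ∑ i, score i := by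
  intro N score t ht
  have hzero : ∑ i, ∑ j, t i j = 0 := by
    have hswap : ∑ i, ∑ j, t i j = ∑ i, ∑ j, t j i := Finset.sum_comm
    have hneg : ∑ i : Fin N, ∑ j : Fin N, t j i = -∑ i, ∑ j, t i j := by
      rw [← Finset.sum_neg_distrib]
      refine Finset.sum_congr rfl fun i _ => ?_
      rw [← Finset.sum_neg_distrib]
      exact Finset.sum_congr rfl fun j _ => by rw [ht j i]
    linarith
  rw [Finset.sum_add_distrib, hzero, add_zero]

/-- **KEPLER at one scale from a pointwise envelope.** If `Σ_i μ_i ≤ Σ_i λ_i`, `e ≤ μ_i` at every site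
and `e + c ≤ μ_i` at every bad site, with `c ≥ 0`, then `c · #bad ≤ Σ_i λ_i − N·e`. [folklore] -/
theorem stub_keplerOfPointwise : ∀ (e c : ℝ) (N : ℕ) (score μ : Fin N → ℝ) (bad : Fin N → Prop), 0 ≤ c → ∑ i, μ i ≤ ∑ i, score i → (∀ i, e ≤ μ i) → (∀ i, bad i → e + c ≤ μ i) → c * (Nat.card {i : Fin N // bad i} : ℝ) ≤ ∑ i, score i - (N : ℝ) * e := by
  intro e c N score μ bad hc hsum hfloor hbad
  classical
  -- `#bad` as the cardinality of a filtered finset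
  have hcard : (Nat.card {i : Fin N // bad i} : ℝ) = ((Finset.univ.filter fun i : Fin N => bad i).card : ℝ) := by
    rw [Nat.card_eq_fintype_card, Fintype.card_subtype]
  -- pointwise: `e + c · 1[bad i] ≤ μ i`
  have hpt : ∀ i : Fin N, e + c * (if bad i then 1 else 0) ≤ μ i := by
    intro i
    by_cases hi : bad i
    · simpa [hi] using hbad i hi
    · simpa [hi] using hfloor i
  have hsum' : ∑ i : Fin N, (e + c * (if bad i then (1 : ℝ) else 0)) ≤ ∑ i, μ i :=
    Finset.sum_le_sum fun i _ => hpt i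
  have hlhs : ∑ i : Fin N, (e + c * (if bad i then (1 : ℝ) else 0))
      = (N : ℝ) * e + c * ((Finset.univ.filter fun i : Fin N => bad i).card : ℝ) := by
    rw [Finset.sum_add_distrib, Finset.sum_const, Finset.card_univ, Fintype.card_fin, nsmul_eq_mul,
      ← Finset.mul_sum, Finset.sum_boole]
  rw [hcard]
  linarith

end Summit.AtomisticToContinuum.Crystallization.Theorems.FluxCellKeplerSketch
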